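import Summits.CriticalPhenomena.CardyFormulaZ2.Theorems.HalfPlaneMarkDensityLaw.Negative.CardyContent

/-!
# `HalfPlaneMarkDensityLaw` (crux stmt-CriticalPhenomena-5661): no uniformity down to `x = c`
# (a natural strengthening refuted; negative-side support, 4/4)

Support file of the crux disprover (cdisprove seat, 2026-08-16); `sorry`-free, standard axioms.

`not_uniformLaw`: the crux made UNIFORM in the position of the fourth mark over `(c,x)` is false
(instance `0,1,2,3`): the claimed density blows up like `(x−c)^{−2/3}` (`density_lower_bound`) while
`n·P[E_n] ≤ n`.  So the convergence can be at best locally uniform on compacts of `(c,∞)`; the usable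
tightness statement at the mark is that the first `εn` sites carry total mass
`P[A_n ↔ [⌊cn⌋,⌊(c+ε)n⌋]×{0}] → F(η(c+ε)) = O(ε^{1/3})` (files `MarkEvents` §2, `CardyContent` §3).
-/

noncomputable section

namespace Summit.CriticalPhenomena.CardyFormulaZ2.Theorems.HalfPlaneMarkDensityLaw.Negative

open Literature.Probability.Percolation Literature.Probability.LatticeModels
open Literature.Probability.RandomPlanarGeometry
open MeasureTheory Filter Set
open scoped ENNReal NNReal Topology
open Summit.CriticalPhenomena.CardyFormulaZ2.Theses.CardyBoundaryCoulombGas (HalfPlaneMarkDensityLaw)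

/-- Cardy's function `F` (the `RandomPlanarGeometry` copy; `Percolation.cardyFunction` agrees by `rfl`). -/
local notation "𝔽" => Literature.Probability.RandomPlanarGeometry.cardyFunction


/-! ## §6 A natural strengthening refuted: no uniformity down to `x = c`

The claimed density blows up like `(x−c)^{−2/3}` at the left end while `n·P[E_n] ≤ n` trivially, so
the convergence in the crux can be at best LOCALLY uniform on compacts of `(c,∞)`; the version
uniform on `(c,x)` (the uniform law) is false for every `n` (`not_uniformLaw`).  The planner's glue
`DensityIntegration` therefore needs local uniformity on compacts PLUS a separate tightness estimate at
the marks (the lattice mass of the first `εn` sites is `P[A_n ↔ [⌊cn⌋,⌊(c+ε)n⌋]] → F(η(c+ε)) = O(ε^{1/3})`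
by §2–§3, which is the form in which the singularity is integrable). -/

/-- Lower bound for the density near `c` in the instance `(0,1,2)`: for `0 < s ≤ 1/2` and
`y = 2 + s³/6`, `density 0 1 2 y ≥ (cardyConst/3)·s⁻²`. [folklore] -/
lemma density_lower_bound {s : ℝ} (hs : 0 < s) (hs1 : s ≤ 1 / 2) :
    cardyConst / 3 * (s ^ 2)⁻¹ ≤ density 0 1 2 (2 + s ^ 3 / 6) := by
  set y : ℝ := 2 + s ^ 3 / 6 with hy
  have hs3 : s ^ 3 ≤ 1 / 8 := by nlinarith [pow_le_pow_left₀ hs.le hs1 3]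
  have hy2 : 0 < y - 2 := by have := pow_pos hs 3; rw [hy]; linarith
  have hy3 : y < 3 := by rw [hy]; nlinarith
  have hK : 0 < cardyConst / 3 := by have := cardyConst_pos; positivity
  -- density 0 1 2 y = K * 2^{1/3} * (y(y-1)(y-2))^{-2/3}
  have hdens : density 0 1 2 y = cardyConst / 3 * (2 : ℝ) ^ (1 / 3 : ℝ) *
      (y * (y - 1) * (y - 2)) ^ (-(2 / 3) : ℝ) := by
    simp only [density]; norm_num
  rw [hdens]
  have h2 : (1 : ℝ) ≤ (2 : ℝ) ^ (1 / 3 : ℝ) := Real.one_le_rpow (by norm_num) (by norm_num)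
  -- monotonicity: y(y-1)(y-2) ≤ 6 (y-2) = s^3, exponent negative
  have hprod_pos : 0 < y * (y - 1) * (y - 2) := by
    have : 0 < y := by linarith
    have : 0 < y - 1 := by linarith
    positivity
  have hprod_le : y * (y - 1) * (y - 2) ≤ s ^ 3 := by
    have h6 : y * (y - 1) ≤ 6 := by nlinarith
    calc y * (y - 1) * (y - 2) ≤ 6 * (y - 2) := by nlinarith
      _ = s ^ 3 := by rw [hy]; ring
  have hmono : (s ^ 3) ^ (-(2 / 3) : ℝ) ≤ (y * (y - 1) * (y - 2)) ^ (-(2 / 3) : ℝ) :=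
    Real.rpow_le_rpow_of_nonpos hprod_pos hprod_le (by norm_num)
  rw [pow_three_rpow_neg_two_thirds hs] at hmono
  calc cardyConst / 3 * (s ^ 2)⁻¹ = cardyConst / 3 * 1 * (s ^ 2)⁻¹ := by ring
    _ ≤ cardyConst / 3 * (2 : ℝ) ^ (1 / 3 : ℝ) * (y * (y - 1) * (y - 2)) ^ (-(2 / 3) : ℝ) := by
        gcongr

/-- **§6 main**: the uniform-on-`(c,x)` strengthening of the crux is FALSE (instance `a,b,c,x =
0,1,2,3`: at the stage `N` where the uniform distance drops below `1`, the point `y = 2 + s³/6` with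
`s = min(1/2, K/(N+1))`, `K = cardyConst/3`, has `density ≥ 2(N+1) > N·P + 1`). [folklore] -/
theorem not_uniformLaw : ¬ ∀ a b c x : ℝ, a < b → b < c → c < x →
    TendstoUniformlyOn (fun (n : ℕ) (y : ℝ) ↦ (n : ℝ) * μ.real (markEvent a b c y n))
      (fun y ↦ density a b c y) atTop (Ioo c x) := by
  intro h
  have hu := h 0 1 2 3 (by norm_num) (by norm_num) (by norm_num)
  rw [Metric.tendstoUniformlyOn_iff] at hu
  obtain ⟨N, hN⟩ := (hu 1 one_pos).exists_forall_of_atTop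
  have hK : 0 < cardyConst / 3 := by have := cardyConst_pos; positivity
  set s : ℝ := min (1 / 2) (cardyConst / 3 / (N + 1)) with hs
  have hs0 : 0 < s := by rw [hs]; positivity
  have hs1 : s ≤ 1 / 2 := min_le_left _ _
  have hs2 : s ≤ cardyConst / 3 / (N + 1) := min_le_right _ _
  set y : ℝ := 2 + s ^ 3 / 6 with hy
  have hs3 : s ^ 3 ≤ 1 / 8 := by nlinarith [pow_le_pow_left₀ hs0.le hs1 3]
  have hymem : y ∈ Ioo (2 : ℝ) 3 :=
    ⟨by have := pow_pos hs0 3; rw [hy]; linarith, by rw [hy]; nlinarith⟩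
  have hNy := hN N le_rfl y hymem
  rw [Real.dist_eq, abs_sub_lt_iff] at hNy
  have hP : (N : ℝ) * μ.real (markEvent 0 1 2 y N) ≤ N := by
    have : μ.real (markEvent 0 1 2 y N) ≤ 1 := measureReal_le_one
    have hN0 : (0 : ℝ) ≤ N := Nat.cast_nonneg N
    nlinarith
  have hlow := density_lower_bound hs0 hs1
  -- K / s² ≥ 2 (N+1): from s ≤ K/(N+1) and s ≤ 1/2 we get s² ≤ (1/2) K/(N+1)
  have hs_sq : s ^ 2 ≤ 1 / 2 * (cardyConst / 3 / (N + 1)) := by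
    rw [pow_two]; exact mul_le_mul hs1 hs2 hs0.le (by norm_num)
  have hbig : 2 * ((N : ℝ) + 1) ≤ cardyConst / 3 * (s ^ 2)⁻¹ := by
    rw [← div_eq_mul_inv, le_div_iff₀ (by positivity)]
    have hN1 : (0 : ℝ) < N + 1 := by positivity
    calc 2 * ((N : ℝ) + 1) * s ^ 2 ≤ 2 * ((N : ℝ) + 1) * (1 / 2 * (cardyConst / 3 / (N + 1))) := by
          gcongr
      _ = cardyConst / 3 := by field_simp
  linarith [hNy.1]

end Summit.CriticalPhenomena.CardyFormulaZ2.Theorems.HalfPlaneMarkDensityLaw.Negative
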